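import Summits.ValiantsHypothesis.ValiantsHypothesis.Theorems.DualUnipotentThreeHalves.Negative.HeavyTopInstThreeFive

/-!
# `GrenetZeon.DualUnipotentThreeHalves` (stmt-ValiantsHypothesis-24318) — line «radical_split» §8, instance table of R2:
# the FAR-CORNER pencil of format `(4,7)` — DEFINITIONS and basic facts

24318 `HeavyTopLaw` INSTRUMENT (director-valiant g13 R259 (a) / R263; instrument pen val-port-3 g2 named this cut 15:14Z:
«the (4,7) far-corner negative»; this file val-port-2 g2).  The witness data for the `(4,7)` entry, on the pattern of the
`(3,5)` witness `topFive` / `NFive` of `…WordDefs` (✓, val-idea-9 g4 / val-port-1 g2):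

* `topSeven v` — the FAR-CORNER top space of format `(4,7)` parametrised by `v : ℂ^{4×4}`: the fifteen strictly upper entries
  `(i,j)` of a `7 × 7` matrix with `j − i ≤ 3` and the far entry `(1,5)` carry the sixteen coordinates; the other five entries
  with `j − i ≥ 4` are zero (port-3 g2's INSTANCES.md v1 (5): «tops = NT₇ ∩ {5 of the 6 entries with j − i ≥ 4 = 0}»).
* `NSeven : AffMat 4 7` — the LINEAR pencil with `N(x) = topSeven x`.
* basic facts: `isAffine_NSeven`, `NSeven_strictUpper`, `NSeven_pow` (`N⁷ = 0`), `NSeven_map_eval`, `linPart_NSeven`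
  (values and tops are `topSeven`), `eq_zero_of_topSeven_eq_zero` (the top map is injective).

The helper files `…HeavyTopInstFourSeven{Toolkit, Blocks, BudgetOne}` (budget `≤ 1` impossible) and the verdict file
`…DualUnipotentThreeHalves/Negative/HeavyTopInstFourSeven` (budget `2` impossible, `¬ HeavyTopInst 4 7`) import this one.  Honest framing: DEFINITIONS + bookkeeping for ONE tiny format of R2's instance
table (`--supports stmt-ValiantsHypothesis-24318 --as helper`); nothing here asserts or refutes R2 `HeavyTopLaw`, S3b, the crux
`DualUnipotentThreeHalves`, rung 8062 or `VP ≠ VNP` — all OPEN / NOT proved. [this line's workfile §8; ✓ `…Negative.HeavyTopInstThreeFive`]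
-/

-- `Summit.ValiantsHypothesis.ValiantsHypothesis.…` repeats a component (D-0017 layout); `dupNamespace` would flag the mandated name.
set_option linter.dupNamespace false
set_option autoImplicit false

noncomputable section

namespace Summit.ValiantsHypothesis.ValiantsHypothesis.Theorems.GrenetZeon.RadicalSplit

open MvPolynomial Matrix
open scoped BigOperators
open Summit.ValiantsHypothesis.ValiantsHypothesis.Cruxes.TwoDimCoefficients.DimTwoCases (AffMat IsAffine)

/-! ## The far-corner top space and pencil of format `(4,7)` -/

/-- The FAR-CORNER top space of format `(4,7)` parametrised by `ℂ^{4×4}`: all strictly upper entries `(i,j)` of a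
`7 × 7` matrix with `j − i ≤ 3` (15 of them) plus the far entry `(1,5)`; the other five entries with `j − i ≥ 4` are zero. -/
def topSeven (v : Fin 4 × Fin 4 → ℂ) : Matrix (Fin 7) (Fin 7) ℂ :=
  !![0, v (0,0), v (0,1), v (0,2), v (0,3), 0, 0;
     0, 0, v (1,0), v (1,1), v (1,2), 0, 0;
     0, 0, 0, v (2,0), v (2,1), v (2,2), 0;
     0, 0, 0, 0, v (3,0), v (3,1), v (3,2);
     0, 0, 0, 0, 0, v (1,3), v (2,3);
     0, 0, 0, 0, 0, 0, v (3,3);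
     0, 0, 0, 0, 0, 0, 0]

/-- The linear `7 × 7` pencil over `ℂ^{4×4}` with `N(x) = topSeven x` (the far-corner pencil of format `(4,7)`). -/
def NSeven : AffMat 4 7 :=
  !![0, X (0,0), X (0,1), X (0,2), X (0,3), 0, 0;
     0, 0, X (1,0), X (1,1), X (1,2), 0, 0;
     0, 0, 0, X (2,0), X (2,1), X (2,2), 0;
     0, 0, 0, 0, X (3,0), X (3,1), X (3,2);
     0, 0, 0, 0, 0, X (1,3), X (2,3);
     0, 0, 0, 0, 0, 0, X (3,3);
     0, 0, 0, 0, 0, 0, 0]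

/-! ## Basic facts -/

/-- `NSeven` is an affine (indeed linear) pencil. -/
theorem isAffine_NSeven : IsAffine NSeven := by
  intro i j
  fin_cases i <;> fin_cases j <;> simp [NSeven, MvPolynomial.totalDegree_X]

/-- `NSeven` is strictly upper triangular. -/
theorem NSeven_strictUpper : ∀ a b : Fin 7, (b : ℕ) ≤ a → NSeven a b = 0 := by
  intro a b h
  fin_cases a <;> fin_cases b <;> simp [NSeven] at h ⊢

/-- `NSeven` is nilpotent of index `≤ 7`. -/
theorem NSeven_pow : NSeven ^ 7 = 0 :=
  pow_eq_zero_of_strictUpper NSeven NSeven_strictUpper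

/-- The values of `NSeven`: `N(x) = topSeven x`. -/
theorem NSeven_map_eval (x : Fin 4 × Fin 4 → ℂ) : NSeven.map (MvPolynomial.eval x) = topSeven x := by
  ext i j
  fin_cases i <;> fin_cases j <;> simp [NSeven, topSeven]

/-- The tops of `NSeven`: `N_lin(v) = topSeven v`. -/
theorem linPart_NSeven (v : Fin 4 × Fin 4 → ℂ) : linPart NSeven v = topSeven v := by
  unfold linPart
  rw [NSeven_map_eval, NSeven_map_eval]
  ext i j
  fin_cases i <;> fin_cases j <;> simp [topSeven]

/-- The top map is injective: `topSeven v = 0 → v = 0`. -/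
theorem eq_zero_of_topSeven_eq_zero (v : Fin 4 × Fin 4 → ℂ) (h : topSeven v = 0) : v = 0 := by
  funext c
  obtain ⟨i, j⟩ := c
  fin_cases i <;> fin_cases j
  · simpa [topSeven] using congr_fun (congr_fun h 0) 1
  · simpa [topSeven] using congr_fun (congr_fun h 0) 2
  · simpa [topSeven] using congr_fun (congr_fun h 0) 3
  · simpa [topSeven] using congr_fun (congr_fun h 0) 4
  · simpa [topSeven] using congr_fun (congr_fun h 1) 2
  · simpa [topSeven] using congr_fun (congr_fun h 1) 3
  · simpa [topSeven] using congr_fun (congr_fun h 1) 4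
  · simpa [topSeven] using congr_fun (congr_fun h 4) 5
  · simpa [topSeven] using congr_fun (congr_fun h 2) 3
  · simpa [topSeven] using congr_fun (congr_fun h 2) 4
  · simpa [topSeven] using congr_fun (congr_fun h 2) 5
  · simpa [topSeven] using congr_fun (congr_fun h 4) 6
  · simpa [topSeven] using congr_fun (congr_fun h 3) 4
  · simpa [topSeven] using congr_fun (congr_fun h 3) 5
  · simpa [topSeven] using congr_fun (congr_fun h 3) 6
  · simpa [topSeven] using congr_fun (congr_fun h 5) 6

end Summit.ValiantsHypothesis.ValiantsHypothesis.Theorems.GrenetZeon.RadicalSplit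

end
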